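import Mathlib
import Literature.Barriers.ValiantsHypothesis.AlgebraicNaturalProofs
import Literature.Computability.AlgebraicComplexity.ProjectedShiftedPartials
import Literature.Computability.AlgebraicComplexity.SlidingWindowDerivatives
import Literature.Computability.AlgebraicComplexity.StandardFamilies
import Literature.Computability.AlgebraicComplexity.ArithCircuitProofs
import Summits.ValiantsHypothesis.ValiantsHypothesis.Theorems.BarrierLeverSuccinctHittingSetsForVPRazDeterminant
import Summits.ValiantsHypothesis.ValiantsHypothesis.Theorems.BarrierLeverSuccinctHittingSetsForVPDimensionCount
import Summits.ValiantsHypothesis.ValiantsHypothesis.Theorems.BarrierLeverSuccinctHittingSetsForVPStubPartitionDeterminantLevel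
import HarnessLib

/-!
# Crux `BarrierLever.SuccinctHittingSetsForVP` (stmt-ValiantsHypothesis-14610), line `registered` —
stubs `stub_lowRankAnnihilated` and `stub_separableSumsAnnihilated`: THE MINORS OF A
VARIABLE-PARTITION FLATTENING ARE NONZERO LEVEL-8 DISTINGUISHERS THAT ANNIHILATE EVERY COEFFICIENT
VECTOR OF LOW FLATTENING RANK; ONE OF THEM KILLS ALL SUMS OF `t < 2^(n/2)` SEPARABLE TENSORS

**What is proved (unconditional; it does NOT close the item — it is the NEGATIVE structural fact
steering the line).** Fix `n ≥ 10`, a finite index type `κ` with `t < |κ| ≤ N = C(2n, n)`, and two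
INJECTIVE families of exponent vectors: rows `p_k` supported on the variables `x_i`, `i < h`, and
columns `q_l` supported on `x_i`, `i ≥ h`, all of degree `≤ n/2`. The `κ × κ` minor
`D = det [c_(p_k + q_l)]_(k, l)` of the flattening of the coefficient tensor along the partition
`{x_0 … x_(h-1)} ⊔ {x_h … x_(n-1)}` is the generic determinant `detPoly κ ℂ` renamed into the
coefficient variables `c_(p_k + q_l)` (`|p_k + q_l| ≤ n`).

* `LowRankAnnihilated.add_injective_of_support` : the renaming map `(k, l) ↦ p_k + q_l` is
  injective (restrict an identity `p_k + q_l = p_k' + q_l'` to the coordinates `i < h`, where every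
  `q` vanishes, and to `i ≥ h`, where every `p` vanishes).
* `LowRankAnnihilated.rename_detPoly_mem_distinguishers` : `D ∈ Distinguishers ℂ n 8` — size
  `≤ 8 (|κ| + 1)^7 ≤ N^8` by Berkowitz (`PartitionDeterminantLevel.complexity_detPoly_fintype_le`,
  `PartitionDeterminantLevel.size_arith`, `N ≥ 1024`), degree `≤ |κ| ≤ N ≤ N^8`.
* `LowRankAnnihilated.rename_detPoly_ne_zero` : `D ≠ 0` (`rename` along an injective map is
  injective, and `DET ≠ 0`, `Matrix.det_mvPolynomialX_ne_zero`).
* `LowRankAnnihilated.eval_coeffVector_minor` : `D(coeff f) = det [coeff_(p_k + q_l) f]`.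
* `LowRankAnnihilated.det_mul_eq_zero_of_lt` : a `κ × κ` matrix factoring through `Fin t`,
  `t < |κ|`, is singular (`rank (P Q) ≤ rank P ≤ t < |κ| = rank` of a unit).
* `LowRankAnnihilated.prod_add_split` : for `m = a + b` with `a` supported below `h` and `b`
  supported at or above `h`, `∏_i g_i(m_i) = (∏_(i<h) g_i(a_i)) · (∏_(i≥h) g_i(b_i))` — a
  separable (rank-one) tensor has flattening rank one.
* `LowRankAnnihilated.exists_multilinear_families` : the `2^(n/2)` multilinear row monomials
  `x_S`, `S ⊆ {0 … n/2 - 1}`, and column monomials `x_(S + n/2)` (the tree's `KumarSaraf.chi`).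
* `stub_lowRankAnnihilated`, `stub_separableSumsAnnihilated` : the registered stubs, verbatim;
  the second applies the first with `h = n/2`, `κ = Finset (Fin (n/2))`, and factors every sum of
  `t` separable tensors `Σ_(j<t) ∏_i c_(j,i)(m_i)` through `Fin t` by `prod_add_split`.

Meaning for the line: the `t`-seed separable generator (FSV Construction 25, as realised by
`stub_separableCoeff`) has flattening rank `≤ t` across the balanced partition, so for every
`t < 2^(n/2)` ONE nonzero level-8 distinguisher vanishes on its whole image — adding seeds to that
generator cannot settle the crux. Mirror of `PartitionDeterminantLevel.partDet_mem_distinguishers`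
(p166330) for families instead of a subtype-and-bijection. The hypothesis `2h ≤ n` of the first
registered signature is not used. Axioms: `propext`, `Classical.choice`, `Quot.sound`. No new
definitions.

References: [Nisan1991Noncommutative] N. Nisan, STOC 1991 (partition rank of coefficient
matrices); [ForbesShpilkaVolk2018] M. Forbes, A. Shpilka, B. L. Volk, Theory Comput. 14 (2018),
§1.2 (rank methods are algebraically natural), Construction 25, Question 6; [Berkowitz1984]
S. J. Berkowitz, Inform. Process. Lett. 18 (1984) (`DET ∈ VP`); [Landsberg2017] J. M. Landsberg,
Geometry and Complexity Theory (2017), §8 (flattenings and their minors).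
-/

-- layout Summits/ValiantsHypothesis/ValiantsHypothesis forces the duplicated namespace component
set_option linter.dupNamespace false

namespace Summit.ValiantsHypothesis.ValiantsHypothesis.Theorems.BarrierLever.SuccinctHittingSetsForVP

open Literature.Barriers.ValiantsHypothesis Literature.Computability.AlgebraicComplexity
open MvPolynomial

namespace LowRankAnnihilated

open KumarSaraf

/-! ### The flattening minor as a polynomial in the coefficient variables -/

/-- Degree bookkeeping: `|p + q| = |p| + |q| ≤ n/2 + n/2 ≤ n`. [folklore] -/
theorem degree_add_le_of {n : ℕ} {p q : Fin n →₀ ℕ} (hp : 2 * p.degree ≤ n)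
    (hq : 2 * q.degree ≤ n) : (p + q).degree ≤ n := by
  rw [map_add]
  omega

/-- On the low coordinates `i < h` the column part vanishes: `(p_k + q_l) i = p_k i`. [folklore] -/
theorem add_apply_of_lt {n h : ℕ} {a b : Fin n →₀ ℕ} (hb : ∀ i ∈ b.support, h ≤ (i : ℕ))
    {i : Fin n} (hi : (i : ℕ) < h) : (a + b) i = a i := by
  rw [Finsupp.add_apply,
    Finsupp.notMem_support_iff.mp fun hm => absurd (hb i hm) (not_le.mpr hi), add_zero]

/-- On the high coordinates `i ≥ h` the row part vanishes: `(p_k + q_l) i = q_l i`. [folklore] -/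
theorem add_apply_of_not_lt {n h : ℕ} {a b : Fin n →₀ ℕ} (ha : ∀ i ∈ a.support, (i : ℕ) < h)
    {i : Fin n} (hi : ¬ (i : ℕ) < h) : (a + b) i = b i := by
  rw [Finsupp.add_apply, Finsupp.notMem_support_iff.mp fun hm => hi (ha i hm), zero_add]

/-- **The renaming map `(k, l) ↦ p_k + q_l` is injective** when the rows `p` (supported on the
variables below `h`) and the columns `q` (supported at or above `h`) are injective families:
restrict `p_k + q_l = p_k' + q_l'` to the two halves of the coordinates. [folklore] -/
theorem add_injective_of_support {n h : ℕ} {κ : Type*} (p q : κ → (Fin n →₀ ℕ))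
    (hp : Function.Injective p) (hq : Function.Injective q)
    (hps : ∀ k, ∀ i ∈ (p k).support, (i : ℕ) < h) (hqs : ∀ k, ∀ i ∈ (q k).support, h ≤ (i : ℕ)) :
    Function.Injective fun kl : κ × κ => p kl.1 + q kl.2 := by
  rintro ⟨k, l⟩ ⟨k', l'⟩ hkl
  simp only at hkl
  have hk : p k = p k' := by
    ext i
    by_cases hi : (i : ℕ) < h
    · rw [← add_apply_of_lt (hqs l) hi, hkl, add_apply_of_lt (hqs l') hi]
    · rw [Finsupp.notMem_support_iff.mp fun hm => hi (hps k i hm),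
        Finsupp.notMem_support_iff.mp fun hm => hi (hps k' i hm)]
  have hl : q l = q l' := by
    ext i
    by_cases hi : (i : ℕ) < h
    · rw [Finsupp.notMem_support_iff.mp fun hm => absurd (hqs l i hm) (not_le.mpr hi),
        Finsupp.notMem_support_iff.mp fun hm => absurd (hqs l' i hm) (not_le.mpr hi)]
    · rw [← add_apply_of_not_lt (hps k) hi, hkl, add_apply_of_not_lt (hps k') hi]
  exact Prod.ext (hp hk) (hq hl)

/-- **A renamed generic determinant of size `|κ| ≤ N` is a level-8 distinguisher** for `n ≥ 10`:
size `≤ 8 (|κ|+1)^7 ≤ 1024 N^7 ≤ N^8` (`N = C(2n, n) ≥ 2^n ≥ 1024`) by Berkowitz and renaming,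
degree `≤ |κ| ≤ N ≤ N^8`. [cite: ForbesShpilkaVolk2018, Cor. 5 and §1.2] -/
theorem rename_detPoly_mem_distinguishers {n : ℕ} (hn : 10 ≤ n) {κ : Type*} [Fintype κ]
    [DecidableEq κ] (hκ : Fintype.card κ ≤ (2 * n).choose n) (e : κ × κ → degLEMonomials n) :
    rename e (detPoly κ ℂ) ∈ Distinguishers ℂ n 8 := by
  have hN : 1024 ≤ (2 * n).choose n := PartitionDeterminantLevel.choose_ge_1024 hn
  refine ⟨(complexity_rename_le_holds' _ _).trans
    ((PartitionDeterminantLevel.complexity_detPoly_fintype_le _).trans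
      (PartitionDeterminantLevel.size_arith hκ hN)), ?_⟩
  refine (totalDegree_rename_le _ _).trans ?_
  calc (detPoly κ ℂ).totalDegree ≤ Fintype.card κ := detPoly_isHomogeneous.totalDegree_le
    _ ≤ (2 * n).choose n := hκ
    _ = ((2 * n).choose n) ^ 1 := (pow_one _).symm
    _ ≤ ((2 * n).choose n) ^ 8 := Nat.pow_le_pow_right (by omega) (by norm_num)

/-- **A generic determinant renamed along an injective map is nonzero** (`rename` along an
injective map is injective; `DET ≠ 0` as it is `1` at the identity matrix). [folklore] -/
theorem rename_detPoly_ne_zero {κ τ : Type*} [Fintype κ] [DecidableEq κ] (e : κ × κ → τ)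
    (he : Function.Injective e) : rename e (detPoly κ ℂ) ≠ 0 := by
  intro h0
  rw [← map_zero (rename e)] at h0
  exact Matrix.det_mvPolynomialX_ne_zero κ ℂ (rename_injective e he h0)

/-- **The flattening minor is a polynomial in the coefficient variables**: the value of
`rename ((k, l) ↦ c_(p_k + q_l)) DET_κ` at the coefficient vector of `f` is
`det [coeff_(p_k + q_l) f]_(k, l)` (`eval_rename` + `eval_detPoly`; the entries agree
definitionally, `coeffVector_apply`). [folklore] -/
theorem eval_coeffVector_minor {n h : ℕ} {κ : Type*} [Fintype κ] [DecidableEq κ]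
    (p q : κ → (Fin n →₀ ℕ))
    (hp2 : ∀ k, (∀ i ∈ (p k).support, (i : ℕ) < h) ∧ 2 * (p k).degree ≤ n)
    (hq2 : ∀ k, (∀ i ∈ (q k).support, h ≤ (i : ℕ)) ∧ 2 * (q k).degree ≤ n)
    (f : MvPolynomial (Fin n) ℂ) :
    eval (coeffVector (degLEMonomials n) f)
        (rename (fun kl : κ × κ =>
          (⟨p kl.1 + q kl.2, degree_add_le_of (hp2 kl.1).2 (hq2 kl.2).2⟩ : degLEMonomials n))
          (detPoly κ ℂ)) =
      (Matrix.of fun k l : κ => coeff (p k + q l) f).det := by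
  rw [eval_rename, eval_detPoly]
  rfl

/-! ### Low rank kills the minor -/

/-- **A square matrix factoring through a smaller space is singular**: if `M = P Q` with
`P : κ × t`, `Q : t × κ` and `t < |κ|` then `det M = 0` (otherwise `M` is a unit of rank `|κ|`,
but `rank (P Q) ≤ rank P ≤ t`). [folklore] -/
theorem det_mul_eq_zero_of_lt {κ : Type*} [Fintype κ] [DecidableEq κ] {t : ℕ}
    (ht : t < Fintype.card κ) (P : Matrix κ (Fin t) ℂ) (Q : Matrix (Fin t) κ ℂ) :
    (P * Q).det = 0 := by
  by_contra hne
  have hU : IsUnit (P * Q) := (Matrix.isUnit_iff_isUnit_det _).mpr (isUnit_iff_ne_zero.mpr hne)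
  have h1 : (P * Q).rank = Fintype.card κ := Matrix.rank_of_isUnit _ hU
  have h2 : (P * Q).rank ≤ Fintype.card (Fin t) :=
    (Matrix.rank_mul_le_left P Q).trans (Matrix.rank_le_card_width P)
  rw [Fintype.card_fin] at h2
  omega

/-- **A separable tensor has flattening rank one**: for `a` supported below `h` and `b` supported
at or above `h`, `∏_i g_i((a + b)_i) = (∏_(i<h) g_i(a_i)) · (∏_(i≥h) g_i(b_i))`.
[cite: ForbesShpilkaVolk2018, Construction 25] -/
theorem prod_add_split {n h : ℕ} {R : Type*} [CommMonoid R] (a b : Fin n →₀ ℕ)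
    (ha : ∀ i ∈ a.support, (i : ℕ) < h) (hb : ∀ i ∈ b.support, h ≤ (i : ℕ)) (g : Fin n → ℕ → R) :
    ∏ i, g i ((a + b) i) =
      (∏ i : Fin n, if (i : ℕ) < h then g i (a i) else 1) *
        ∏ i : Fin n, if (i : ℕ) < h then 1 else g i (b i) := by
  rw [← Finset.prod_mul_distrib]
  refine Finset.prod_congr rfl fun i _ => ?_
  by_cases hi : (i : ℕ) < h
  · rw [if_pos hi, if_pos hi, mul_one, add_apply_of_lt hb hi]
  · rw [if_neg hi, if_neg hi, one_mul, add_apply_of_not_lt ha hi]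

/-! ### The multilinear rows and columns of the balanced partition -/

/-- Rows / columns from an embedding `Fin h ↪ Fin n`, `2h ≤ n`: the multilinear monomials `x_(ι S)`,
`S ⊆ Fin h` (indicator exponent vectors `KumarSaraf.chi`, injective in the set by the tree's
`KumarSaraf.chi_injective`), form an injective family, supported on the range of `ι`, of degree
`|S| ≤ h ≤ n/2`. [folklore] -/
theorem multilinear_family {n h : ℕ} (hh : 2 * h ≤ n) (ι : Fin h ↪ Fin n) (P : ℕ → Prop)
    (hP : ∀ s : Fin h, P (ι s)) :
    Function.Injective (fun S : Finset (Fin h) => chi (S.map ι)) ∧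
      ∀ S : Finset (Fin h), (∀ i ∈ (chi (S.map ι)).support, P i) ∧ 2 * (chi (S.map ι)).degree ≤ n := by
  refine ⟨fun S S' hSS' => Finset.map_injective ι (chi_injective hSS'), fun S => ⟨fun i hi => ?_, ?_⟩⟩
  · rw [support_chi, Finset.mem_map] at hi
    obtain ⟨s, -, rfl⟩ := hi
    exact hP s
  · rw [degree_chi, Finset.card_map]
    have := S.card_le_univ
    rw [Fintype.card_fin] at this
    omega

/-- **The balanced multilinear flattening has `2^(n/2)` injective rows and columns**: rows
`x_S` (`S ⊆ {0 … n/2 - 1}`), columns `x_(S + n/2)` (`S + n/2 ⊆ {n/2 … 2 (n/2) - 1}`), both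
indexed by `Finset (Fin (n/2))`, with the support and degree constraints of
`stub_lowRankAnnihilated` for `h = n/2`. [folklore] -/
theorem exists_multilinear_families (n : ℕ) :
    ∃ p q : Finset (Fin (n / 2)) → (Fin n →₀ ℕ), Function.Injective p ∧ Function.Injective q ∧
      (∀ S, (∀ i ∈ (p S).support, (i : ℕ) < n / 2) ∧ 2 * (p S).degree ≤ n) ∧
      (∀ T, (∀ i ∈ (q T).support, n / 2 ≤ (i : ℕ)) ∧ 2 * (q T).degree ≤ n) := by
  have h2 : 2 * (n / 2) ≤ n := Nat.mul_div_le n 2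
  obtain ⟨hp, hp2⟩ := multilinear_family h2 (Fin.castLEEmb (Nat.div_le_self n 2))
    (fun i => i < n / 2) fun s => s.2
  obtain ⟨hq, hq2⟩ := multilinear_family h2
    ⟨fun s : Fin (n / 2) => (⟨(s : ℕ) + n / 2, by omega⟩ : Fin n), fun a b hab => Fin.ext (by
      have := congrArg Fin.val hab
      simp only at this
      omega)⟩
    (fun i => n / 2 ≤ i) fun s => Nat.le_add_left _ _
  exact ⟨_, _, hp, hq, hp2, hq2⟩

/-- `|Finset (Fin (n/2))| = 2^(n/2) ≤ 2^n ≤ C(2n, n)` for `n ≥ 4`. [folklore] -/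
theorem card_finset_fin_half_le {n : ℕ} (hn : 4 ≤ n) :
    Fintype.card (Finset (Fin (n / 2))) ≤ (2 * n).choose n := by
  rw [Fintype.card_finset, Fintype.card_fin]
  exact (Nat.pow_le_pow_right (by norm_num) (Nat.div_le_self n 2)).trans
    (LowDegreeEquations.two_pow_le_choose hn)

end LowRankAnnihilated

open LowRankAnnihilated

/-- **Registered stub `stub_lowRankAnnihilated`** (crux stmt-ValiantsHypothesis-14610, line
`registered`, wave 10): NO-GO FOR LOW-PARTITION-RANK GENERATORS — for `n ≥ 10`, `t < |κ| ≤ N` and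
injective families of row monomials `p_k` (in `x_0 … x_(h-1)`, `2|p_k| ≤ n`) and column monomials
`q_k` (in `x_h … x_(n-1)`, `2|q_k| ≤ n`), the minor `D = det [c_(p_k + q_l)]_(k,l)` is a NONZERO
member of `Distinguishers ℂ n 8` (generic determinant renamed injectively into the coefficient
variables; Berkowitz size `8 (|κ|+1)^7 ≤ N^8`) that computes `det [coeff_(p_k + q_l) f]` and
VANISHES at every `f` whose `κ × κ` block factors through `Fin t` (rank `≤ t < |κ|`).
[cite: ForbesShpilkaVolk2018, §1.2 and Question 6] -/
theorem stub_lowRankAnnihilated :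
    ∀ n h : ℕ, 10 ≤ n → 2 * h ≤ n →
      ∀ (κ : Type) [Fintype κ] [DecidableEq κ] (t : ℕ), t < Fintype.card κ →
        Fintype.card κ ≤ Nat.choose (2 * n) n →
        ∀ (p q : κ → (Fin n →₀ ℕ)), Function.Injective p → Function.Injective q →
          (∀ k, (∀ i ∈ (p k).support, (i : ℕ) < h) ∧ 2 * (p k).degree ≤ n) →
          (∀ k, (∀ i ∈ (q k).support, h ≤ (i : ℕ)) ∧ 2 * (q k).degree ≤ n) →
          ∃ D ∈ Distinguishers ℂ n 8, D ≠ 0 ∧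
            (∀ f : MvPolynomial (Fin n) ℂ, MvPolynomial.eval (coeffVector (degLEMonomials n) f) D =
              (Matrix.of fun k l : κ => MvPolynomial.coeff (p k + q l) f).det) ∧
            ∀ f : MvPolynomial (Fin n) ℂ,
              (∃ (P : κ → Fin t → ℂ) (Q : Fin t → κ → ℂ),
                  ∀ k l, MvPolynomial.coeff (p k + q l) f = ∑ s, P k s * Q s l) →
                MvPolynomial.eval (coeffVector (degLEMonomials n) f) D = 0 := by
  intro n h hn _ κ _ _ t ht hκ p q hp hq hp2 hq2
  refine ⟨rename (fun kl : κ × κ =>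
      (⟨p kl.1 + q kl.2, degree_add_le_of (hp2 kl.1).2 (hq2 kl.2).2⟩ : degLEMonomials n))
      (detPoly κ ℂ),
    rename_detPoly_mem_distinguishers hn hκ _,
    rename_detPoly_ne_zero _ (fun a b hab => add_injective_of_support p q hp hq
      (fun k => (hp2 k).1) (fun k => (hq2 k).1) (congrArg Subtype.val hab)),
    eval_coeffVector_minor p q hp2 hq2, ?_⟩
  rintro f ⟨P, Q, hPQ⟩
  have hM : (Matrix.of fun k l : κ => coeff (p k + q l) f) = Matrix.of P * Matrix.of Q := by
    ext k l
    rw [Matrix.mul_apply, Matrix.of_apply]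
    simp only [Matrix.of_apply]
    exact hPQ k l
  rw [eval_coeffVector_minor p q hp2 hq2, hM]
  exact det_mul_eq_zero_of_lt ht _ _

/-- **Registered stub `stub_separableSumsAnnihilated`** (crux stmt-ValiantsHypothesis-14610, line
`registered`, wave 10): THE SEPARABLE GENERATOR TOOLKIT IS ANNIHILATED AT EVERY SEED COUNT
`t < 2^(n/2)` — for `n ≥ 10` there is ONE nonzero `D ∈ Distinguishers ℂ n 8` vanishing at every `f`
whose degree-`≤ n` coefficients are a sum of `t` separable tensors `Σ_(j<t) ∏_i c_(j,i)(m_i)`.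
From `stub_lowRankAnnihilated` with `h = n/2`, rows / columns the `2^(n/2)` multilinear monomials
`x_S` / `x_(S + n/2)`: a sum of `t` separable tensors has flattening rank `≤ t`, since
`∏_i c_(j,i)((x_S x_(T+n/2))_i) = ∏_(i<n/2) c_(j,i)(𝟙_S i) · ∏_(i≥n/2) c_(j,i)(𝟙_(T+n/2) i)`.
[cite: ForbesShpilkaVolk2018, Construction 25 and Question 6] -/
theorem stub_separableSumsAnnihilated :
    ∀ n : ℕ, 10 ≤ n → ∀ t : ℕ, t < 2 ^ (n / 2) →
      ∃ D ∈ Distinguishers ℂ n 8, D ≠ 0 ∧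
        ∀ (c : Fin t → Fin n → ℕ → ℂ) (f : MvPolynomial (Fin n) ℂ),
          (∀ m : Fin n →₀ ℕ, m.degree ≤ n → MvPolynomial.coeff m f = ∑ j, ∏ i, c j i (m i)) →
          MvPolynomial.eval (coeffVector (degLEMonomials n) f) D = 0 := by
  intro n hn t ht
  obtain ⟨p, q, hp, hq, hp2, hq2⟩ := exists_multilinear_families n
  have hcard : t < Fintype.card (Finset (Fin (n / 2))) := by
    rwa [Fintype.card_finset, Fintype.card_fin]
  obtain ⟨D, hD, hD0, -, hvan⟩ := stub_lowRankAnnihilated n (n / 2) hn (Nat.mul_div_le n 2)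
    (Finset (Fin (n / 2))) t hcard (card_finset_fin_half_le (by omega)) p q hp hq hp2 hq2
  refine ⟨D, hD, hD0, fun c f hcf => hvan f
    ⟨fun S j => ∏ i : Fin n, if (i : ℕ) < n / 2 then c j i (p S i) else 1,
      fun j T => ∏ i : Fin n, if (i : ℕ) < n / 2 then 1 else c j i (q T i), fun S T => ?_⟩⟩
  rw [hcf _ (degree_add_le_of (hp2 S).2 (hq2 T).2)]
  exact Finset.sum_congr rfl fun j _ => prod_add_split (p S) (q T) (hp2 S).1 (hq2 T).1 (c j)

end Summit.ValiantsHypothesis.ValiantsHypothesis.Theorems.BarrierLever.SuccinctHittingSetsForVP
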